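import Mathlib
/-! # Stub `stub_sectorCover` — crux `TwoProducts` (stmt-ValiantsHypothesis-5906), line `corner-log-linearization`
   Every combinatorial vertex `e` of `F = ∏ f − ∏ g` (unique minimiser of an integer form `⟨w, ·⟩` on `supp F`)
   lies in the sector set of an ADAPTED datum `(μ, ν, r₁, r₂)` for some sector `(r₁, r₂) ∈ Sec`: perturb `w` to a
   generic integer weight `w' = L•w + (1, M)` keeping `e` the unique minimiser (integer gaps are `≥ 1`), sweep `w'`
   into a sector, and take `μ j, ν j :=` the unique `w'`-minimisers of the factor supports.  Two adapted data of one
   sector with nonempty sector sets coincide (`⟨rᵢ, μ j − μ' j⟩ = 0`, `i = 1, 2`, `det ≠ 0`), so the vertices are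
   covered by `#Sec` sets of size `≤ B`.  [folklore] -/
set_option linter.dupNamespace false -- single-conjunct summit: `ValiantsHypothesis.ValiantsHypothesis`
namespace Summit.ValiantsHypothesis.ValiantsHypothesis.Theorems.TwoProducts.SectorCover
open scoped BigOperators

/-- If `|c| < L` and `x ≥ 1` then `L x + c > 0`. [folklore] -/
theorem pos_of_abs_lt (L x c : ℤ) (hc : |c| < L) (hx : 0 < x) : 0 < L * x + c := by
  have hL : 0 ≤ L := (abs_nonneg c).trans hc.le
  have h1 : L * 1 ≤ L * x := mul_le_mul_of_nonneg_left (by omega) hL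
  have h2 : -c ≤ |c| := neg_le_abs c
  linarith

/-- If `|c| < L` and `L x + c = 0` then `x = 0`. [folklore] -/
theorem eq_zero_of_abs_lt (L x c : ℤ) (hc : |c| < L) (h : L * x + c = 0) : x = 0 := by
  rcases lt_trichotomy x 0 with hx | hx | hx
  · have := pos_of_abs_lt L (-x) (-c) (by rwa [abs_neg]) (by omega)
    linarith
  · exact hx
  · have := pos_of_abs_lt L x c hc hx
    linarith

/-- PERTURBATION: any integer weight `w` is refined, on a finite set `U` of exponents, by a GENERIC integer weight
`w'` (both coordinates nonzero, injective on `U`) — `w'` strictly orders every pair that `w` strictly orders.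
[folklore] -/
theorem exists_generic_refinement (U : Finset (Fin 2 →₀ ℕ)) (w : Fin 2 → ℤ) :
    ∃ w' : Fin 2 → ℤ, w' 0 ≠ 0 ∧ w' 1 ≠ 0 ∧
      ∀ p ∈ U, ∀ q ∈ U, p ≠ q →
        w' 0 * (p 0 : ℤ) + w' 1 * (p 1 : ℤ) ≠ w' 0 * (q 0 : ℤ) + w' 1 * (q 1 : ℤ) ∧
        (w 0 * (p 0 : ℤ) + w 1 * (p 1 : ℤ) < w 0 * (q 0 : ℤ) + w 1 * (q 1 : ℤ) →
          w' 0 * (p 0 : ℤ) + w' 1 * (p 1 : ℤ) < w' 0 * (q 0 : ℤ) + w' 1 * (q 1 : ℤ)) := by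
  -- a slope `M ≥ 1` exceeding every first coordinate occurring in `U`
  obtain ⟨M, hM1, hMU⟩ : ∃ M : ℤ, 1 ≤ M ∧ ∀ p ∈ U, (p 0 : ℤ) < M := by
    refine ⟨1 + ∑ p ∈ U, (p 0 : ℤ), ?_, fun p hp => ?_⟩
    · have : 0 ≤ ∑ p ∈ U, (p 0 : ℤ) := Finset.sum_nonneg fun p _ => by positivity
      linarith
    · have : (p 0 : ℤ) ≤ ∑ q ∈ U, (q 0 : ℤ) :=
        Finset.single_le_sum (f := fun q : Fin 2 →₀ ℕ => (q 0 : ℤ)) (fun q _ => by positivity) hp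
      linarith
  -- the form `φ p = p 0 + M * p 1` is injective on `U`
  have hφ : ∀ p ∈ U, ∀ q ∈ U, p ≠ q → (p 0 : ℤ) + M * (p 1 : ℤ) ≠ (q 0 : ℤ) + M * (q 1 : ℤ) := by
    intro p hp q hq hpq h
    have hp0 := hMU p hp
    have hq0 := hMU q hq
    have hp0' : (0 : ℤ) ≤ p 0 := by positivity
    have hq0' : (0 : ℤ) ≤ q 0 := by positivity
    rcases lt_trichotomy (p 1 : ℤ) (q 1 : ℤ) with h1 | h1 | h1
    · have : M * 1 ≤ M * ((q 1 : ℤ) - p 1) := mul_le_mul_of_nonneg_left (by omega) (by omega)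
      linarith
    · apply hpq
      have h0 : (p 0 : ℤ) = q 0 := by rw [h1] at h; linarith
      ext i
      fin_cases i
      · exact_mod_cast h0
      · exact_mod_cast h1
    · have : M * 1 ≤ M * ((p 1 : ℤ) - q 1) := mul_le_mul_of_nonneg_left (by omega) (by omega)
      linarith
  -- a scale `L > M` exceeding every difference of `φ`-values on `U`
  obtain ⟨L, hLM, hLU⟩ : ∃ L : ℤ, M < L ∧
      ∀ p ∈ U, ∀ q ∈ U, |((p 0 : ℤ) + M * (p 1 : ℤ)) - ((q 0 : ℤ) + M * (q 1 : ℤ))| < L := by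
    refine ⟨1 + M + ∑ p ∈ U, ((p 0 : ℤ) + M * (p 1 : ℤ)), ?_, fun p hp q hq => ?_⟩
    · have : 0 ≤ ∑ p ∈ U, ((p 0 : ℤ) + M * (p 1 : ℤ)) := Finset.sum_nonneg fun p _ => by positivity
      linarith
    · have hp' : (p 0 : ℤ) + M * (p 1 : ℤ) ≤ ∑ q ∈ U, ((q 0 : ℤ) + M * (q 1 : ℤ)) :=
        Finset.single_le_sum (f := fun q : Fin 2 →₀ ℕ => (q 0 : ℤ) + M * (q 1 : ℤ))
          (fun q _ => by positivity) hp
      have hq' : (q 0 : ℤ) + M * (q 1 : ℤ) ≤ ∑ q ∈ U, ((q 0 : ℤ) + M * (q 1 : ℤ)) :=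
        Finset.single_le_sum (f := fun q : Fin 2 →₀ ℕ => (q 0 : ℤ) + M * (q 1 : ℤ))
          (fun q _ => by positivity) hq
      have : 0 ≤ (p 0 : ℤ) + M * (p 1 : ℤ) := by positivity
      have : 0 ≤ (q 0 : ℤ) + M * (q 1 : ℤ) := by positivity
      rw [abs_lt]
      constructor <;> linarith
  refine ⟨![L * w 0 + 1, L * w 1 + M], ?_, ?_, ?_⟩
  · simp only [Matrix.cons_val_zero]
    intro h
    have h0 := eq_zero_of_abs_lt L (w 0) 1 (by rw [abs_one]; linarith) h
    rw [h0] at h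
    simp at h
  · simp only [Matrix.cons_val_one, Matrix.cons_val_fin_one]
    intro h
    have h0 := eq_zero_of_abs_lt L (w 1) M (by rw [abs_of_pos (by linarith)]; linarith) h
    rw [h0] at h
    linarith
  · intro p hp q hq hpq
    simp only [Matrix.cons_val_zero, Matrix.cons_val_one, Matrix.cons_val_fin_one]
    have key : ∀ r : Fin 2 →₀ ℕ, (L * w 0 + 1) * (r 0 : ℤ) + (L * w 1 + M) * (r 1 : ℤ) =
        L * (w 0 * (r 0 : ℤ) + w 1 * (r 1 : ℤ)) + ((r 0 : ℤ) + M * (r 1 : ℤ)) := fun r => by ring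
    rw [key p, key q]
    refine ⟨fun h => ?_, fun h => ?_⟩
    · have h' : L * ((w 0 * (p 0 : ℤ) + w 1 * (p 1 : ℤ)) - (w 0 * (q 0 : ℤ) + w 1 * (q 1 : ℤ))) +
          (((p 0 : ℤ) + M * (p 1 : ℤ)) - ((q 0 : ℤ) + M * (q 1 : ℤ))) = 0 := by linarith
      have h0 := eq_zero_of_abs_lt L _ _ (hLU p hp q hq) h'
      rw [h0, mul_zero, zero_add, sub_eq_zero] at h'
      exact hφ p hp q hq hpq h'
    · have h' := pos_of_abs_lt L ((w 0 * (q 0 : ℤ) + w 1 * (q 1 : ℤ)) - (w 0 * (p 0 : ℤ) + w 1 * (p 1 : ℤ)))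
        (((q 0 : ℤ) + M * (q 1 : ℤ)) - ((p 0 : ℤ) + M * (p 1 : ℤ))) (hLU q hq p hp) (by linarith)
      linarith

/-- A weight that is injective on a nonempty finite set of exponents has a UNIQUE minimiser there. [folklore] -/
theorem exists_strictMin (S : Finset (Fin 2 →₀ ℕ)) (w : Fin 2 → ℤ) (hS : S.Nonempty)
    (hinj : ∀ p ∈ S, ∀ q ∈ S, p ≠ q →
      w 0 * (p 0 : ℤ) + w 1 * (p 1 : ℤ) ≠ w 0 * (q 0 : ℤ) + w 1 * (q 1 : ℤ)) :
    ∃ μ, μ ∈ S ∧ ∀ e' ∈ S, e' ≠ μ →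
      w 0 * (μ 0 : ℤ) + w 1 * (μ 1 : ℤ) < w 0 * (e' 0 : ℤ) + w 1 * (e' 1 : ℤ) := by
  obtain ⟨μ, hμ, hmin⟩ := S.exists_min_image (fun e => w 0 * (e 0 : ℤ) + w 1 * (e 1 : ℤ)) hS
  exact ⟨μ, hμ, fun e' he' hne => lt_of_le_of_ne (hmin e' he') (hinj μ hμ e' he' (Ne.symm hne))⟩

/-- Scaling a weight by `K > 0` preserves strict inequalities between weights of exponents. [folklore] -/
theorem wt_lt_of_smul_eq (K : ℤ) (hK : 0 < K) (w W : Fin 2 → ℤ) (hW : K • w = W) (p q : Fin 2 →₀ ℕ)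
    (h : w 0 * (p 0 : ℤ) + w 1 * (p 1 : ℤ) < w 0 * (q 0 : ℤ) + w 1 * (q 1 : ℤ)) :
    W 0 * (p 0 : ℤ) + W 1 * (p 1 : ℤ) < W 0 * (q 0 : ℤ) + W 1 * (q 1 : ℤ) := by
  subst hW
  simp only [Pi.smul_apply, smul_eq_mul]
  have := mul_lt_mul_of_pos_left h hK
  linarith

/-- 2×2 elimination over `ℤ`: if two forms with nonzero determinant both weakly order `p` before `q` AND `q`
before `p`, then `p = q` (adapted data of one sector share their minimisers). [folklore] -/
theorem eq_of_wt_le_le (r₁ r₂ : Fin 2 → ℤ) (hdet : r₁ 0 * r₂ 1 ≠ r₁ 1 * r₂ 0) (p q : Fin 2 →₀ ℕ)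
    (hpq : r₁ 0 * (p 0 : ℤ) + r₁ 1 * (p 1 : ℤ) ≤ r₁ 0 * (q 0 : ℤ) + r₁ 1 * (q 1 : ℤ) ∧
      r₂ 0 * (p 0 : ℤ) + r₂ 1 * (p 1 : ℤ) ≤ r₂ 0 * (q 0 : ℤ) + r₂ 1 * (q 1 : ℤ))
    (hqp : r₁ 0 * (q 0 : ℤ) + r₁ 1 * (q 1 : ℤ) ≤ r₁ 0 * (p 0 : ℤ) + r₁ 1 * (p 1 : ℤ) ∧
      r₂ 0 * (q 0 : ℤ) + r₂ 1 * (q 1 : ℤ) ≤ r₂ 0 * (p 0 : ℤ) + r₂ 1 * (p 1 : ℤ)) : p = q := by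
  have h₁ := le_antisymm hpq.1 hqp.1
  have h₂ := le_antisymm hpq.2 hqp.2
  have hd : r₁ 0 * r₂ 1 - r₁ 1 * r₂ 0 ≠ 0 := sub_ne_zero.2 hdet
  have hx : (r₁ 0 * r₂ 1 - r₁ 1 * r₂ 0) * ((p 0 : ℤ) - q 0) = 0 := by
    linear_combination (r₂ 1) * h₁ - (r₁ 1) * h₂
  have hy : (r₁ 0 * r₂ 1 - r₁ 1 * r₂ 0) * ((p 1 : ℤ) - q 1) = 0 := by
    linear_combination (r₁ 0) * h₂ - (r₂ 0) * h₁
  have h0 := sub_eq_zero.1 ((mul_eq_zero.1 hx).resolve_left hd)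
  have h1 := sub_eq_zero.1 ((mul_eq_zero.1 hy).resolve_left hd)
  ext i
  fin_cases i
  · exact_mod_cast h0
  · exact_mod_cast h1

/-- ABSTRACT COUNT: if every vertex lies in the sector set of an adapted datum of some sector of `Sec`, adapted data of
one sector with nonempty sector sets are unique, and adapted sector sets have `≤ B` elements, then there are
`≤ #Sec · B` vertices. [folklore] -/
theorem ncard_le_card_mul_of_cover {ι σ₁ σ₂ E : Type*} {Sec : Finset (ι × ι)} {B : ℕ}
    {A : σ₁ → σ₂ → ι → ι → Prop} {T : σ₁ → σ₂ → ι → ι → Set E} {V : Set E} (S₀ : Finset E)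
    (hB : ∀ μ ν r₁ r₂, A μ ν r₁ r₂ → (T μ ν r₁ r₂).ncard ≤ B)
    (hsub : ∀ μ ν r₁ r₂, T μ ν r₁ r₂ ⊆ ↑S₀)
    (hcover : ∀ e ∈ V, ∃ rr ∈ Sec, ∃ μ ν, A μ ν rr.1 rr.2 ∧ e ∈ T μ ν rr.1 rr.2)
    (huniq : ∀ rr ∈ Sec, ∀ μ ν μ' ν', A μ ν rr.1 rr.2 → A μ' ν' rr.1 rr.2 →
      (T μ ν rr.1 rr.2).Nonempty → (T μ' ν' rr.1 rr.2).Nonempty → μ = μ' ∧ ν = ν') :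
    V.ncard ≤ Sec.card * B := by
  obtain ⟨U, hU⟩ : ∃ U : ι × ι → Set E, ∀ rr e, e ∈ U rr ↔ ∃ μ ν, A μ ν rr.1 rr.2 ∧ e ∈ T μ ν rr.1 rr.2 :=
    ⟨fun rr => {e | ∃ μ ν, A μ ν rr.1 rr.2 ∧ e ∈ T μ ν rr.1 rr.2}, fun _ _ => Iff.rfl⟩
  have hUB : ∀ rr ∈ Sec, (U rr).ncard ≤ B := by
    intro rr hrr
    rcases (U rr).eq_empty_or_nonempty with h0 | ⟨e₀, he₀⟩
    · rw [h0, Set.ncard_empty]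
      exact Nat.zero_le _
    · obtain ⟨μ₀, ν₀, hA₀, he₀⟩ := (hU rr e₀).1 he₀
      refine (Set.ncard_le_ncard ?_ (S₀.finite_toSet.subset (hsub μ₀ ν₀ rr.1 rr.2))).trans
        (hB _ _ _ _ hA₀)
      intro e he
      obtain ⟨μ, ν, hA, he⟩ := (hU rr e).1 he
      obtain ⟨rfl, rfl⟩ := huniq rr hrr μ ν μ₀ ν₀ hA hA₀ ⟨e, he⟩ ⟨e₀, he₀⟩
      exact he
  have hVsub : V ⊆ ⋃ rr ∈ Sec, U rr := by
    intro e he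
    obtain ⟨rr, hrr, μ, ν, hA, heT⟩ := hcover e he
    exact Set.mem_biUnion (Finset.mem_coe.2 hrr) ((hU rr e).2 ⟨μ, ν, hA, heT⟩)
  have hUsub : (⋃ rr ∈ Sec, U rr) ⊆ ↑S₀ := by
    intro e he
    simp only [Set.mem_iUnion] at he
    obtain ⟨rr, -, he⟩ := he
    obtain ⟨μ, ν, -, heT⟩ := (hU rr e).1 he
    exact hsub _ _ _ _ heT
  calc V.ncard ≤ (⋃ rr ∈ Sec, U rr).ncard := Set.ncard_le_ncard hVsub (S₀.finite_toSet.subset hUsub)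
    _ ≤ ∑ rr ∈ Sec, (U rr).ncard := Finset.set_ncard_biUnion_le _ _
    _ ≤ ∑ rr ∈ Sec, B := Finset.sum_le_sum hUB
    _ = Sec.card * B := by rw [Finset.sum_const, smul_eq_mul]

/-- SECTOR COVER: for families `f, g` of nonzero bivariate polynomials, a finite family `Sec` of sectors sweeping every
generic integer weight (weakly order-consistently on the factor supports), and a bound `B` on the sector set of every
adapted datum `(μ, ν, r₁, r₂)`, the polynomial `∏ f − ∏ g` has at most `#Sec · B` combinatorial vertices (unique
minimisers of some integer form on its support). [folklore] -/
theorem stub_sectorCover : ∀ (m t : ℕ) (f g : Fin m → MvPolynomial (Fin 2) ℂ),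
    (∀ j, (f j).support.card ≤ t) → (∀ j, (g j).support.card ≤ t) → (∀ j, f j ≠ 0) → (∀ j, g j ≠ 0) →
    ∀ (Sec : Finset ((Fin 2 → ℤ) × (Fin 2 → ℤ))),
    (∀ w : Fin 2 → ℤ, w 0 ≠ 0 → w 1 ≠ 0 →
      (∀ j, ∀ p ∈ (f j).support, ∀ q ∈ (f j).support, p ≠ q →
        w 0 * (p 0 : ℤ) + w 1 * (p 1 : ℤ) ≠ w 0 * (q 0 : ℤ) + w 1 * (q 1 : ℤ)) →
      (∀ j, ∀ p ∈ (g j).support, ∀ q ∈ (g j).support, p ≠ q →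
        w 0 * (p 0 : ℤ) + w 1 * (p 1 : ℤ) ≠ w 0 * (q 0 : ℤ) + w 1 * (q 1 : ℤ)) →
      ∃ rr ∈ Sec, rr.1 0 * rr.2 1 ≠ rr.1 1 * rr.2 0 ∧
        ∃ a b K : ℤ, 0 < a ∧ 0 < b ∧ 0 < K ∧ K • w = a • rr.1 + b • rr.2 ∧
          (∀ j, ∀ p ∈ (f j).support, ∀ q ∈ (f j).support,
            w 0 * (p 0 : ℤ) + w 1 * (p 1 : ℤ) < w 0 * (q 0 : ℤ) + w 1 * (q 1 : ℤ) →
            rr.1 0 * (p 0 : ℤ) + rr.1 1 * (p 1 : ℤ) ≤ rr.1 0 * (q 0 : ℤ) + rr.1 1 * (q 1 : ℤ) ∧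
            rr.2 0 * (p 0 : ℤ) + rr.2 1 * (p 1 : ℤ) ≤ rr.2 0 * (q 0 : ℤ) + rr.2 1 * (q 1 : ℤ)) ∧
          (∀ j, ∀ p ∈ (g j).support, ∀ q ∈ (g j).support,
            w 0 * (p 0 : ℤ) + w 1 * (p 1 : ℤ) < w 0 * (q 0 : ℤ) + w 1 * (q 1 : ℤ) →
            rr.1 0 * (p 0 : ℤ) + rr.1 1 * (p 1 : ℤ) ≤ rr.1 0 * (q 0 : ℤ) + rr.1 1 * (q 1 : ℤ) ∧
            rr.2 0 * (p 0 : ℤ) + rr.2 1 * (p 1 : ℤ) ≤ rr.2 0 * (q 0 : ℤ) + rr.2 1 * (q 1 : ℤ))) →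
    ∀ B : ℕ,
    (∀ (μ ν : Fin m → (Fin 2 →₀ ℕ)) (r₁ r₂ : Fin 2 → ℤ),
      (r₁ 0 * r₂ 1 ≠ r₁ 1 * r₂ 0 ∧
        (∀ j, ∀ p ∈ (f j).support,
          r₁ 0 * ((μ j) 0 : ℤ) + r₁ 1 * ((μ j) 1 : ℤ) ≤ r₁ 0 * (p 0 : ℤ) + r₁ 1 * (p 1 : ℤ) ∧
          r₂ 0 * ((μ j) 0 : ℤ) + r₂ 1 * ((μ j) 1 : ℤ) ≤ r₂ 0 * (p 0 : ℤ) + r₂ 1 * (p 1 : ℤ)) ∧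
        (∀ j, ∀ p ∈ (g j).support,
          r₁ 0 * ((ν j) 0 : ℤ) + r₁ 1 * ((ν j) 1 : ℤ) ≤ r₁ 0 * (p 0 : ℤ) + r₁ 1 * (p 1 : ℤ) ∧
          r₂ 0 * ((ν j) 0 : ℤ) + r₂ 1 * ((ν j) 1 : ℤ) ≤ r₂ 0 * (p 0 : ℤ) + r₂ 1 * (p 1 : ℤ))) →
      {e : Fin 2 →₀ ℕ | ∃ a b : ℤ, 0 < a ∧ 0 < b ∧
        (∀ j, μ j ∈ (f j).support ∧ ∀ e' ∈ (f j).support, e' ≠ μ j →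
          (a • r₁ + b • r₂) 0 * ((μ j) 0 : ℤ) + (a • r₁ + b • r₂) 1 * ((μ j) 1 : ℤ) <
            (a • r₁ + b • r₂) 0 * (e' 0 : ℤ) + (a • r₁ + b • r₂) 1 * (e' 1 : ℤ)) ∧
        (∀ j, ν j ∈ (g j).support ∧ ∀ e' ∈ (g j).support, e' ≠ ν j →
          (a • r₁ + b • r₂) 0 * ((ν j) 0 : ℤ) + (a • r₁ + b • r₂) 1 * ((ν j) 1 : ℤ) <
            (a • r₁ + b • r₂) 0 * (e' 0 : ℤ) + (a • r₁ + b • r₂) 1 * (e' 1 : ℤ)) ∧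
        (e ∈ (∏ j, f j - ∏ j, g j).support ∧ ∀ e' ∈ (∏ j, f j - ∏ j, g j).support, e' ≠ e →
          (a • r₁ + b • r₂) 0 * (e 0 : ℤ) + (a • r₁ + b • r₂) 1 * (e 1 : ℤ) <
            (a • r₁ + b • r₂) 0 * (e' 0 : ℤ) + (a • r₁ + b • r₂) 1 * (e' 1 : ℤ))}.ncard ≤ B) →
    {e : Fin 2 →₀ ℕ | ∃ w : Fin 2 → ℤ, e ∈ (∏ j, f j - ∏ j, g j).support ∧
      ∀ e' ∈ (∏ j, f j - ∏ j, g j).support, e' ≠ e →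
        w 0 * (e 0 : ℤ) + w 1 * (e 1 : ℤ) < w 0 * (e' 0 : ℤ) + w 1 * (e' 1 : ℤ)}.ncard ≤ Sec.card * B := by
  intro m t f g _ _ hf0 hg0 Sec hSweep B hB
  classical
  refine ncard_le_card_mul_of_cover (∏ j, f j - ∏ j, g j).support hB ?_ ?_ ?_
  · -- every sector set sits inside `supp F`
    intro μ ν r₁ r₂ e he
    obtain ⟨_, _, -, -, -, -, he, -⟩ := he
    exact Finset.mem_coe.2 he
  · -- COVER: every vertex is a sector vertex of an adapted datum
    rintro e ⟨w, heF, hmin⟩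
    obtain ⟨U, hUF, hUf, hUg⟩ : ∃ U : Finset (Fin 2 →₀ ℕ), (∀ p ∈ (∏ j, f j - ∏ j, g j).support, p ∈ U) ∧
        (∀ j, ∀ p ∈ (f j).support, p ∈ U) ∧ (∀ j, ∀ p ∈ (g j).support, p ∈ U) :=
      ⟨(∏ j, f j - ∏ j, g j).support ∪ Finset.univ.biUnion (fun j => (f j).support) ∪
          Finset.univ.biUnion (fun j => (g j).support),
        fun p hp => Finset.mem_union_left _ (Finset.mem_union_left _ hp),
        fun j p hp => Finset.mem_union_left _ (Finset.mem_union_right _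
          (Finset.mem_biUnion.2 ⟨j, Finset.mem_univ _, hp⟩)),
        fun j p hp => Finset.mem_union_right _ (Finset.mem_biUnion.2 ⟨j, Finset.mem_univ _, hp⟩)⟩
    obtain ⟨w', hw0, hw1, hgen⟩ := exists_generic_refinement U w
    have ntf : ∀ j, ∀ p ∈ (f j).support, ∀ q ∈ (f j).support, p ≠ q →
        w' 0 * (p 0 : ℤ) + w' 1 * (p 1 : ℤ) ≠ w' 0 * (q 0 : ℤ) + w' 1 * (q 1 : ℤ) :=
      fun j p hp q hq hpq => (hgen p (hUf j p hp) q (hUf j q hq) hpq).1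
    have ntg : ∀ j, ∀ p ∈ (g j).support, ∀ q ∈ (g j).support, p ≠ q →
        w' 0 * (p 0 : ℤ) + w' 1 * (p 1 : ℤ) ≠ w' 0 * (q 0 : ℤ) + w' 1 * (q 1 : ℤ) :=
      fun j p hp q hq hpq => (hgen p (hUg j p hp) q (hUg j q hq) hpq).1
    obtain ⟨rr, hrr, hdet, a, b, K, ha, hb, hK, hKw, hCf, hCg⟩ := hSweep w' hw0 hw1 ntf ntg
    choose μ hμmem hμmin using
      fun j => exists_strictMin (f j).support w' (MvPolynomial.support_nonempty.2 (hf0 j)) (ntf j)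
    choose ν hνmem hνmin using
      fun j => exists_strictMin (g j).support w' (MvPolynomial.support_nonempty.2 (hg0 j)) (ntg j)
    refine ⟨rr, hrr, μ, ν, ⟨hdet, fun j p hp => ?_, fun j p hp => ?_⟩, a, b, ha, hb,
      fun j => ⟨hμmem j, fun e' he' hne => wt_lt_of_smul_eq K hK w' _ hKw _ _ (hμmin j e' he' hne)⟩,
      fun j => ⟨hνmem j, fun e' he' hne => wt_lt_of_smul_eq K hK w' _ hKw _ _ (hνmin j e' he' hne)⟩,
      heF, fun e' he' hne => wt_lt_of_smul_eq K hK w' _ hKw _ _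
        ((hgen e (hUF e heF) e' (hUF e' he') (Ne.symm hne)).2 (hmin e' he' hne))⟩
    · by_cases hpe : p = μ j
      · rw [hpe]
        exact ⟨le_rfl, le_rfl⟩
      · exact hCf j (μ j) (hμmem j) p hp (hμmin j p hp hpe)
    · by_cases hpe : p = ν j
      · rw [hpe]
        exact ⟨le_rfl, le_rfl⟩
      · exact hCg j (ν j) (hνmem j) p hp (hνmin j p hp hpe)
  · -- UNIQUENESS of the adapted datum of a sector with nonempty sector set
    rintro rr - μ ν μ' ν' ⟨hdet, hAf, hAg⟩ ⟨-, hAf', hAg'⟩ ⟨_, _, _, -, -, hTf, hTg, -⟩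
      ⟨_, _, _, -, -, hTf', hTg', -⟩
    exact ⟨funext fun j => eq_of_wt_le_le rr.1 rr.2 hdet _ _ (hAf j _ (hTf' j).1) (hAf' j _ (hTf j).1),
      funext fun j => eq_of_wt_le_le rr.1 rr.2 hdet _ _ (hAg j _ (hTg' j).1) (hAg' j _ (hTg j).1)⟩

end Summit.ValiantsHypothesis.ValiantsHypothesis.Theorems.TwoProducts.SectorCover
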